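import Literature.Barriers.ValiantsHypothesis.KRST2022GeneralDegree
import Literature.Computability.AlgebraicComplexity.HomogeneousComponentsComplexity
import HarnessLib

/-!
# The `d = n` frame of FSV Question 6 is without loss: degree transfer for succinct hitting sets
# from `VP` slices, every `d` (Forbes–Shpilka–Volk 2018, Cor. 5 / Question 6; val-lit t21)

Typed literature and bookkeeping; `VP ≠ VNP` is NOT proved and nothing here is progress on it.
FSV Question 6 is OPEN; nothing here decides it.

FSV state Cor. 5 and Question 6 for the coefficient space `𝔽[x_1..x_n]^{≤ d}` of
`N = binom(n+d, n)` coefficient variables and the class `𝒞` of "`poly(n,d)`-size circuits of total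
degree at most `d`" (held text `paper:arxiv-1701.05328` chunk p0008.txt: Cor. 5 at L31–32,
Question 6 at L38–39; Def. 3 succinct hitting set at L16–18, Thm. 4 at L27). The tree's frame (`AlgebraicNaturalProofs.lean`)
types the instance `d = n`: `degLEMonomials n`, `SmallCircuits F n b`, `Distinguishers F n a`
(`N = binom(2n, n)`), and the barrier hypothesis `SuccinctHittingSetsForVP F` ("Question 6 answered
yes") — the route item `BarrierLever.SuccinctHittingSetsForVP` (rung V4) is that `d = n` statement.
This file proves that NOTHING IS LOST: the `d = n` hypothesis implies — indeed is equivalent to —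
the family of statements for EVERY pair `(n, d)` with `poly(n, d)` size bounds, in CKRST's slice
vocabulary (`monomialsDegLE n d`, `vpSlice F n d t`, `N = binom(n+d, n)`). Regime `d ≤ n`: the same
two moves as for the `VNP` side (`KRST2022GeneralDegree.lean`) — rename a degree-`d` distinguisher
into the `d = n` frame at level `n` (`N_d ≤ N_n`, size preserved, degree not increased) and truncate
the hitting polynomial to degree `≤ d`, which for CIRCUITS costs `(d+2)² · L + d + 1` over ANY field
(gate-by-gate homogenisation, BCS Lemma (21.25) = the tree's `complexity_sum_homogeneousComponent_le`;
no interpolation, no restriction on the field). Regime `d ≥ n`: PAD VARIABLES — work at level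
`n' = d` of the frame; a degree-`d` distinguisher in the `binom(n+d,n)` coefficient variables is
renamed along the zero-extension of exponent vectors `Fin n ↪ Fin d` (`binom(n+d,n) ≤ binom(2d,d)`),
hit by some `g ∈ SmallCircuits F d b`, and `g(x_1, …, x_n, 0, …, 0)` (Mathlib's `killCompl`, same
coefficients on the monomials in `x_1..x_n`: `coeff_killCompl`) is an `n`-variate polynomial of
degree `≤ d` and size `≤ d^b`.

* `truncation_mem_vpSlice` — `vpSlice F n d₀ t` ↦ `vpSlice F n d ((d+2)² t + d + 1)` under
  `f ↦ Σ_{i ≤ d} f^{(i)}` (any field, any `d`); `truncation_smallCircuits_mem_vpSlice` — for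
  `f ∈ SmallCircuits F n b`, `d ≤ n`, `n ≥ 4`: the truncation lies in `vpSlice F n d (n^{b+4})`;
* `IsSuccinctHittingSet.vpSlice_of_smallCircuits` — frame transfer `d = n ⟹ d ≤ n` at one level
  `n ≥ 4`;
* `succinctHittingSetsForVP_degLE` — `SuccinctHittingSetsForVP F` implies: for every level `a`
  there are `b, n₀` with, for all `n ≥ n₀` and EVERY `d ≤ n`, `vpSlice F n d (n^b)` a succinct
  hitting set for the polynomials of size and degree `≤ binom(n+d,n)^a` in the `binom(n+d,n)`
  coefficient variables;
* `succinctHittingSetsForVP_iff_degLE` — and conversely (the `d = n` member of the family is the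
  frame hypothesis, definitionally up to `binom(n+n,n) = binom(2n,n)`), so the two are EQUIVALENT;
* `killCompl_castLE_mem_vpSlice` — killing padded variables keeps the slice parameters;
  `IsSuccinctHittingSet.vpSlice_of_smallCircuits_pad` — frame transfer `level d ⟹ (n, d)` for
  `n ≤ d` (hitting class `vpSlice F n d (d^b)`);
* `succinctHittingSetsForVP_allDegrees` — `SuccinctHittingSetsForVP F` implies: for every level `a`
  there are `b, n₀` with, for all `n ≥ n₀` and EVERY `d` (no upper bound), `vpSlice F n d ((n+d)^b)`
  a succinct hitting set for the polynomials of size and degree `≤ binom(n+d,n)^a` — FSV's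
  "`poly(n,d)`-size, degree-`≤ d`" class against "`poly(N)`-size, `poly(N)`-degree" distinguishers,
  `N = binom(n+d,n)`, at every `(n, d)`; `succinctHittingSetsForVP_iff_allDegrees` — EQUIVALENT to
  the frame hypothesis (converse at `d = n` with `(2n)^b ≤ n^{2b}`).

* `not_succinctHittingSetsForVP_of_equations_anyDegree` — the contrapositive in FSV Def. 1 /
  KRST Def. 4 words: a family of nonzero `poly(N)`-size/degree equations vanishing eventually on the
  degree-`≤ d(n)` polynomials of `poly(n + d(n))` circuit size, for ANY degree function `d(n)`,
  denies `SuccinctHittingSetsForVP F`.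

So the route item `BarrierLever.SuccinctHittingSetsForVP` (the `d = n` instance) under-claims
nothing relative to FSV Question 6 with polynomial bounds in `n` and `d` jointly (for all large `n`,
uniformly in `d`). What is NOT covered: regimes where `n` stays bounded while `d → ∞` (the threshold
is on `n`), and size bounds polynomial in `N` rather than in `n + d`. 0 named facts; theorems only;
no new definitions.

## References

* [ForbesShpilkaVolk2018] M. A. Forbes, A. Shpilka, B. L. Volk, *Succinct hitting sets and barriers
  to proving lower bounds for algebraic circuits*, Theory Comput. 14 (2018) (arXiv:1701.05328),
  Cor. 5 and Question 6 (held text chunk p0008.txt:L31–32 and L38–39), Def. 3 / Thm. 4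
  (p0008.txt:L16–27), §1.2 (the space `𝔽[x]^{≤ d}`).
* [ChatterjeeKumarRamyaSaptharishiTengse2020] P. Chatterjee et al., FOCS 2020 (arXiv:2004.14147),
  Def. 1.2 (`x^{≤ d}`, `N = binom(n+d,n)`), Def. 2.2 (the slice `VP(n,d)` = `vpSlice`).
* [BurgisserClausenShokrollahi1997] P. Bürgisser, M. Clausen, M. A. Shokrollahi, *Algebraic
  Complexity Theory*, Lemma (21.25) (homogeneous components of a straight-line program).
-/

noncomputable section

namespace Literature.Barriers.ValiantsHypothesis

open Literature.Computability.AlgebraicComplexity MvPolynomial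

/-! ### Degree truncation inside the slices `VP(n, d)` — any field -/

section Truncation

variable {F : Type*} [Field F]

/-- Monotonicity of the `VP` slice in the size parameter. [folklore] -/
private theorem vpSlice_mono_right {n d t t' : ℕ} (h : t ≤ t') :
    vpSlice F n d t ⊆ vpSlice F n d t' :=
  fun _ hf => ⟨hf.1, hf.2.trans h⟩

/-- **`VP(n, d₀)` is closed under degree truncation, any field**: for `f ∈ vpSlice F n d₀ t` the
truncation `Σ_{i ≤ d} f^{(i)}` has degree `≤ d` and size `≤ (d+2)² · t + d + 1` (gate-by-gate
homogenisation, `complexity_sum_homogeneousComponent_le`).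
[cite: BurgisserClausenShokrollahi1997, Lemma (21.25)] -/
theorem truncation_mem_vpSlice {n d₀ t d : ℕ} {f : MvPolynomial (Fin n) F}
    (hf : f ∈ vpSlice F n d₀ t) :
    ∑ i ∈ Finset.range (d + 1), homogeneousComponent i f ∈
      vpSlice F n d ((d + 2) ^ 2 * t + (d + 1)) := by
  refine ⟨BoolSumTrunc.totalDegree_sum_homogeneousComponent_le f d, ?_⟩
  calc complexity (∑ i ∈ Finset.range (d + 1), homogeneousComponent i f)
      ≤ (d + 2) ^ 2 * complexity f + (d + 1) := complexity_sum_homogeneousComponent_le f d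
    _ ≤ (d + 2) ^ 2 * t + (d + 1) := by gcongr; exact hf.2

/-- Arithmetic: `(d+2)² n^b + d + 1 ≤ n^{b+4}` for `d ≤ n`, `n ≥ 4`. [folklore] -/
private theorem trunc_cost_le_pow {b n d : ℕ} (hn : 4 ≤ n) (hd : d ≤ n) :
    (d + 2) ^ 2 * n ^ b + (d + 1) ≤ n ^ (b + 4) := by
  have h1 : 1 ≤ n ^ b := Nat.one_le_pow _ _ (by omega)
  have h2 : (d + 2) ^ 2 ≤ 4 * n ^ 2 := by nlinarith
  have h3 : d + 1 ≤ n ^ 2 := by nlinarith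
  have h4 : n ^ 2 ≤ n ^ 2 * n ^ b := Nat.le_mul_of_pos_right _ h1
  calc (d + 2) ^ 2 * n ^ b + (d + 1) ≤ 4 * n ^ 2 * n ^ b + n ^ 2 * n ^ b := by
        gcongr
        · exact h3.trans h4
    _ = 5 * (n ^ 2 * n ^ b) := by ring
    _ ≤ n ^ 2 * (n ^ 2 * n ^ b) := Nat.mul_le_mul_right _ (by nlinarith)
    _ = n ^ (b + 4) := by ring

/-- **From `VP(n, n)` to `VP(n, d)`**: for `f ∈ SmallCircuits F n b` (FSV's simple class at `d = n`,
size `n^b`), `d ≤ n` and `n ≥ 4`, the truncation `Σ_{i ≤ d} f^{(i)}` lies in `vpSlice F n d (n^{b+4})`.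
[cite: ForbesShpilkaVolk2018, Cor. 5 (the class of poly(n,d)-size circuits of degree ≤ d)]
locator: paper:arxiv-1701.05328 p0008.txt:L31–32 (Cor. 5) -/
theorem truncation_smallCircuits_mem_vpSlice {n b d : ℕ} (hn : 4 ≤ n) (hd : d ≤ n)
    {f : MvPolynomial (Fin n) F} (hf : f ∈ SmallCircuits F n b) :
    ∑ i ∈ Finset.range (d + 1), homogeneousComponent i f ∈ vpSlice F n d (n ^ (b + 4)) := by
  rw [smallCircuits_eq_vpSlice] at hf
  exact vpSlice_mono_right (trunc_cost_le_pow hn hd) (truncation_mem_vpSlice hf)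

end Truncation

/-! ### Frame transfer `d = n ⟹ d ≤ n` for the simple class, and the equivalence -/

section Transfer

variable {F : Type*} [Field F]

/-- The degree-`≤ d` monomials are degree-`≤ n` monomials when `d ≤ n`. [folklore] -/
private theorem monomialsDegLE_subset_degLEMonomials' {n d : ℕ} (hd : d ≤ n) :
    monomialsDegLE n d ⊆ degLEMonomials n :=
  fun _ hm => le_trans hm hd

/-- `binom(n + d, n) ≤ binom(2n, n)` for `d ≤ n`. [folklore] -/
private theorem choose_add_le_choose_two_mul' {n d : ℕ} (hd : d ≤ n) :
    (n + d).choose n ≤ (2 * n).choose n := by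
  rw [two_mul]
  exact Nat.choose_le_choose n (by omega)

/-- **Frame transfer `d = n ⟹ d ≤ n` for the simple class.** If at level `n ≥ 4` the coefficient
vectors of `SmallCircuits F n b` hit every nonzero level-`a` distinguisher (`binom(2n,n)` coefficient
variables), then for every `d ≤ n` the coefficient vectors on `x^{≤ d}` of `vpSlice F n d (n^{b+4})`
hit every nonzero polynomial of size and degree `≤ binom(n+d,n)^a` in the `binom(n+d,n)` coefficient
variables: rename the degree-`d` distinguisher into the `d = n` frame
(`complexity_rename_of_injective_holds`, `totalDegree_rename_le`, `N_d ≤ N_n`), hit it, truncate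
the hitting polynomial (`truncation_smallCircuits_mem_vpSlice`; coefficients on `x^{≤ d}` unchanged,
`coeffVector_monomialsDegLE_truncation`).
[cite: ForbesShpilkaVolk2018, Cor. 5 and Question 6 (the d-graded frame)]
locator: paper:arxiv-1701.05328 p0008.txt:L31–32 (Cor. 5), L38–39 (Question 6) -/
theorem IsSuccinctHittingSet.vpSlice_of_smallCircuits {n b a d : ℕ} (hn : 4 ≤ n) (hdn : d ≤ n)
    (h : IsSuccinctHittingSet (degLEMonomials n) (SmallCircuits F n b) (Distinguishers F n a)) :
    IsSuccinctHittingSet (monomialsDegLE n d) (vpSlice F n d (n ^ (b + 4)))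
      {P : MvPolynomial (monomialsDegLE n d) F |
        complexity P ≤ ((n + d).choose n) ^ a ∧ P.totalDegree ≤ ((n + d).choose n) ^ a} := by
  intro P hP hP0
  set ι : monomialsDegLE n d → degLEMonomials n :=
    Set.inclusion (monomialsDegLE_subset_degLEMonomials' hdn) with hι_def
  have hι : Function.Injective ι := Set.inclusion_injective _
  have hP'0 : rename ι P ≠ 0 := fun h0 => hP0 (rename_injective ι hι (by rw [h0, map_zero]))
  have hN := choose_add_le_choose_two_mul' hdn
  have hmem : rename ι P ∈ Distinguishers F n a := by
    refine ⟨?_, ?_⟩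
    · rw [complexity_rename_of_injective_holds hι P]
      exact hP.1.trans (Nat.pow_le_pow_left hN a)
    · exact (totalDegree_rename_le _ _).trans (hP.2.trans (Nat.pow_le_pow_left hN a))
  obtain ⟨f, hf, hne⟩ := h (rename ι P) hmem hP'0
  refine ⟨∑ i ∈ Finset.range (d + 1), homogeneousComponent i f,
    truncation_smallCircuits_mem_vpSlice hn hdn hf, ?_⟩
  rw [coeffVector_monomialsDegLE_truncation]
  rwa [eval_rename] at hne

variable [Infinite F]

/-- **FSV Question 6 at `d = n` gives it for every `d ≤ n`.** `SuccinctHittingSetsForVP F` implies: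
for every level `a` there are `b, n₀` such that for all `n ≥ n₀` and every `d ≤ n`,
`vpSlice F n d (n^b)` is a succinct hitting set for the polynomials of size and degree
`≤ binom(n+d,n)^a` in the `binom(n+d,n)` coefficient variables.
[cite: ForbesShpilkaVolk2018, Question 6] locator: paper:arxiv-1701.05328 p0008.txt:L38–39 (Question 6) -/
theorem succinctHittingSetsForVP_degLE (hyp : SuccinctHittingSetsForVP F) :
    ∀ a : ℕ, ∃ b n₀ : ℕ, ∀ n : ℕ, n₀ ≤ n → ∀ d : ℕ, d ≤ n →
      IsSuccinctHittingSet (monomialsDegLE n d) (vpSlice F n d (n ^ b))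
        {P : MvPolynomial (monomialsDegLE n d) F |
          complexity P ≤ ((n + d).choose n) ^ a ∧ P.totalDegree ≤ ((n + d).choose n) ^ a} := by
  intro a
  obtain ⟨b, n₀, h⟩ := hyp a
  refine ⟨b + 4, max n₀ 4, fun n hn d hdn => ?_⟩
  exact (h n ((le_max_left _ _).trans hn)).vpSlice_of_smallCircuits ((le_max_right _ _).trans hn) hdn

/-- Conversely the `d = n` member of the family IS the frame hypothesis (`monomialsDegLE n n =
degLEMonomials n` and `vpSlice F n n (n^b) = SmallCircuits F n b` definitionally,
`binom(n+n,n) = binom(2n,n)`). [cite: ForbesShpilkaVolk2018, Question 6] -/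
theorem succinctHittingSetsForVP_of_degLE
    (h : ∀ a : ℕ, ∃ b n₀ : ℕ, ∀ n : ℕ, n₀ ≤ n → ∀ d : ℕ, d ≤ n →
      IsSuccinctHittingSet (monomialsDegLE n d) (vpSlice F n d (n ^ b))
        {P : MvPolynomial (monomialsDegLE n d) F |
          complexity P ≤ ((n + d).choose n) ^ a ∧ P.totalDegree ≤ ((n + d).choose n) ^ a}) :
    SuccinctHittingSetsForVP F := by
  intro a
  obtain ⟨b, n₀, hb⟩ := h a
  refine ⟨b, n₀, fun n hn => ?_⟩
  have hnn := hb n hn n le_rfl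
  have hN : (n + n).choose n = (2 * n).choose n := by rw [two_mul]
  intro D hD hD0
  exact hnn D (by rw [hN]; exact hD) hD0

/-- **Equivalence**: the tree's `d = n` hypothesis `SuccinctHittingSetsForVP F` (route item
`BarrierLever.SuccinctHittingSetsForVP`, FSV Question 6 "answered yes" at `d = n`) is equivalent to
the family of its degree-`d` versions for all `d ≤ n`. [cite: ForbesShpilkaVolk2018, Question 6] -/
theorem succinctHittingSetsForVP_iff_degLE :
    SuccinctHittingSetsForVP F ↔
      ∀ a : ℕ, ∃ b n₀ : ℕ, ∀ n : ℕ, n₀ ≤ n → ∀ d : ℕ, d ≤ n →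
        IsSuccinctHittingSet (monomialsDegLE n d) (vpSlice F n d (n ^ b))
          {P : MvPolynomial (monomialsDegLE n d) F |
            complexity P ≤ ((n + d).choose n) ^ a ∧ P.totalDegree ≤ ((n + d).choose n) ^ a} :=
  ⟨succinctHittingSetsForVP_degLE, succinctHittingSetsForVP_of_degLE⟩

end Transfer

/-! ### Frame transfer `level d ⟹ (n, d)` for `n ≤ d`: padding variables; all degrees -/

section Padding

variable {F : Type*} [Field F]

/-- **Killing padded variables keeps the slice**: for `n ≤ n'` and `g ∈ vpSlice F n' d t`, the
polynomial `g(x_1, …, x_n, 0, …, 0)` (Mathlib's `killCompl` along `Fin.castLE : Fin n ↪ Fin n'`)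
lies in `vpSlice F n d t` (substituting variables and `0` raises neither degree nor size).
[cite: ForbesShpilkaVolk2018, Cor. 5 (the class of poly(n,d)-size circuits of degree ≤ d)]
locator: paper:arxiv-1701.05328 p0008.txt:L31–32 (Cor. 5) -/
theorem killCompl_castLE_mem_vpSlice {n n' d t : ℕ} (hle : n ≤ n') {g : MvPolynomial (Fin n') F}
    (hg : g ∈ vpSlice F n' d t) :
    killCompl (Fin.castLE_injective hle) g ∈ vpSlice F n d t := by
  classical
  unfold killCompl
  refine ⟨?_, ?_⟩
  · refine (totalDegree_aeval_le_of_le_one _ (fun i => ?_) g).trans hg.1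
    split_ifs
    · exact (isHomogeneous_X F _).totalDegree_le
    · simp
  · refine (complexity_aeval_le g _).trans ?_
    rw [Finset.sum_eq_zero, add_zero]
    · exact hg.2
    · intro i _
      split_ifs
      · exact complexity_X_holds _
      · rw [← C_0]; exact complexity_C_holds _

/-- `binom(n + d, n) ≤ binom(2d, d)` for `n ≤ d`. [folklore] -/
private theorem choose_add_le_choose_two_mul_of_le {n d : ℕ} (hnd : n ≤ d) :
    (n + d).choose n ≤ (2 * d).choose d := by
  rw [Nat.choose_symm_add, two_mul]
  exact Nat.choose_le_choose d (by omega)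

/-- **Frame transfer by padding variables (`n ≤ d`).** If at level `d` the coefficient vectors of
`SmallCircuits F d b` hit every nonzero level-`a` distinguisher (`binom(2d,d)` coefficient variables),
then at `(n, d)` with `n ≤ d` the coefficient vectors on `x^{≤ d}` of `vpSlice F n d (d^b)` hit every
nonzero polynomial of size and degree `≤ binom(n+d,n)^a` in the `binom(n+d,n)` coefficient
variables: rename the distinguisher along the zero-extension of exponent vectors
`(Fin n →₀ ℕ) ↪ (Fin d →₀ ℕ)` (`Finsupp.mapDomain (Fin.castLE _)`, degree preserved —
`Finsupp.degree_mapDomain`; `binom(n+d,n) ≤ binom(2d,d)`), hit it by `g`, and restrict `g` to the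
first `n` variables (`killCompl`, `coeff_killCompl`).
[cite: ForbesShpilkaVolk2018, Cor. 5 and Question 6 (the (n,d)-graded frame)]
locator: paper:arxiv-1701.05328 p0008.txt:L31–32 (Cor. 5), L38–39 (Question 6) -/
theorem IsSuccinctHittingSet.vpSlice_of_smallCircuits_pad {n d b a : ℕ} (hnd : n ≤ d)
    (h : IsSuccinctHittingSet (degLEMonomials d) (SmallCircuits F d b) (Distinguishers F d a)) :
    IsSuccinctHittingSet (monomialsDegLE n d) (vpSlice F n d (d ^ b))
      {P : MvPolynomial (monomialsDegLE n d) F |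
        complexity P ≤ ((n + d).choose n) ^ a ∧ P.totalDegree ≤ ((n + d).choose n) ^ a} := by
  intro P hP hP0
  have hf : Function.Injective (Fin.castLE hnd) := Fin.castLE_injective hnd
  have hιmem : ∀ m : monomialsDegLE n d,
      Finsupp.mapDomain (Fin.castLE hnd) (m : Fin n →₀ ℕ) ∈ degLEMonomials d := by
    intro m
    show (Finsupp.mapDomain (Fin.castLE hnd) (m : Fin n →₀ ℕ)).degree ≤ d
    rw [Finsupp.degree_mapDomain]
    exact m.2
  set ι : monomialsDegLE n d → degLEMonomials d :=
    fun m => ⟨Finsupp.mapDomain (Fin.castLE hnd) (m : Fin n →₀ ℕ), hιmem m⟩ with hι_def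
  have hι : Function.Injective ι := by
    intro m m' hmm'
    have h1 := congrArg Subtype.val hmm'
    exact Subtype.ext (Finsupp.mapDomain_injective hf h1)
  have hP'0 : rename ι P ≠ 0 := fun h0 => hP0 (rename_injective ι hι (by rw [h0, map_zero]))
  have hN := choose_add_le_choose_two_mul_of_le hnd
  have hmem : rename ι P ∈ Distinguishers F d a := by
    refine ⟨?_, ?_⟩
    · rw [complexity_rename_of_injective_holds hι P]
      exact hP.1.trans (Nat.pow_le_pow_left hN a)
    · exact (totalDegree_rename_le _ _).trans (hP.2.trans (Nat.pow_le_pow_left hN a))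
  obtain ⟨g, hg, hne⟩ := h (rename ι P) hmem hP'0
  refine ⟨killCompl hf g, ?_, ?_⟩
  · rw [smallCircuits_eq_vpSlice] at hg
    exact killCompl_castLE_mem_vpSlice hnd hg
  · rw [eval_rename] at hne
    have hcv : coeffVector (monomialsDegLE n d) (killCompl hf g) =
        coeffVector (degLEMonomials d) g ∘ ι := by
      funext m
      simp only [coeffVector_apply, Function.comp_apply, hι_def]
      exact coeff_killCompl hf
    rwa [hcv]

variable [Infinite F]

/-- **FSV Question 6 at `d = n` gives it at EVERY `(n, d)`.** `SuccinctHittingSetsForVP F` implies: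
for every level `a` there are `b, n₀` such that for all `n ≥ n₀` and every `d` (no upper bound),
`vpSlice F n d ((n + d)^b)` — FSV's "`poly(n,d)`-size circuits of degree `≤ d`" — is a succinct
hitting set for the polynomials of size and degree `≤ binom(n+d,n)^a` in the `N = binom(n+d,n)`
coefficient variables. (`d ≤ n`: `IsSuccinctHittingSet.vpSlice_of_smallCircuits` at level `n`;
`d > n`: `IsSuccinctHittingSet.vpSlice_of_smallCircuits_pad` at level `d`.)
[cite: ForbesShpilkaVolk2018, Question 6] locator: paper:arxiv-1701.05328 p0008.txt:L38–39 (Question 6) -/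
theorem succinctHittingSetsForVP_allDegrees (hyp : SuccinctHittingSetsForVP F) :
    ∀ a : ℕ, ∃ b n₀ : ℕ, ∀ n : ℕ, n₀ ≤ n → ∀ d : ℕ,
      IsSuccinctHittingSet (monomialsDegLE n d) (vpSlice F n d ((n + d) ^ b))
        {P : MvPolynomial (monomialsDegLE n d) F |
          complexity P ≤ ((n + d).choose n) ^ a ∧ P.totalDegree ≤ ((n + d).choose n) ^ a} := by
  intro a
  obtain ⟨b, n₀, h⟩ := hyp a
  refine ⟨b + 4, max n₀ 4, fun n hn d => ?_⟩
  have hn₀ : n₀ ≤ n := (le_max_left _ _).trans hn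
  have h4 : 4 ≤ n := (le_max_right _ _).trans hn
  rcases le_or_gt d n with hdn | hnd
  · exact ((h n hn₀).vpSlice_of_smallCircuits h4 hdn).mono
      (vpSlice_mono_right (Nat.pow_le_pow_left (Nat.le_add_right n d) _)) le_rfl
  · refine ((h d (by omega)).vpSlice_of_smallCircuits_pad hnd.le).mono
      (vpSlice_mono_right ?_) le_rfl
    calc d ^ b ≤ (n + d) ^ b := Nat.pow_le_pow_left (Nat.le_add_left d n) _
      _ ≤ (n + d) ^ (b + 4) := Nat.pow_le_pow_right (by omega) (by omega)

/-- Conversely the `d = n` members of the all-degrees family give back the frame hypothesis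
(`(2n)^b ≤ n^{2b}` for `n ≥ 2`). [cite: ForbesShpilkaVolk2018, Question 6] -/
theorem succinctHittingSetsForVP_of_allDegrees
    (h : ∀ a : ℕ, ∃ b n₀ : ℕ, ∀ n : ℕ, n₀ ≤ n → ∀ d : ℕ,
      IsSuccinctHittingSet (monomialsDegLE n d) (vpSlice F n d ((n + d) ^ b))
        {P : MvPolynomial (monomialsDegLE n d) F |
          complexity P ≤ ((n + d).choose n) ^ a ∧ P.totalDegree ≤ ((n + d).choose n) ^ a}) :
    SuccinctHittingSetsForVP F := by
  intro a
  obtain ⟨b, n₀, hb⟩ := h a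
  refine ⟨2 * b, max n₀ 2, fun n hn => ?_⟩
  have h2 : 2 ≤ n := (le_max_right _ _).trans hn
  have hnn := hb n ((le_max_left _ _).trans hn) n
  have hN : (n + n).choose n = (2 * n).choose n := by rw [two_mul]
  have hsub : vpSlice F n n ((n + n) ^ b) ⊆ SmallCircuits F n (2 * b) := by
    rw [smallCircuits_eq_vpSlice]
    refine vpSlice_mono_right ?_
    calc (n + n) ^ b ≤ (n ^ 2) ^ b := Nat.pow_le_pow_left (by nlinarith) b
      _ = n ^ (2 * b) := by rw [← pow_mul]
  intro D hD hD0
  obtain ⟨f, hf, hne⟩ := hnn D (by rw [hN]; exact hD) hD0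
  exact ⟨f, hsub hf, hne⟩

/-- **Equivalence, all degrees**: the tree's `d = n` hypothesis `SuccinctHittingSetsForVP F` (route
item `BarrierLever.SuccinctHittingSetsForVP`) is equivalent to FSV Question 6 "answered yes" at
every `(n, d)` with `poly(n+d)` size and `poly(binom(n+d,n))` distinguishers, eventually in `n`,
uniformly in `d`. [cite: ForbesShpilkaVolk2018, Question 6] -/
theorem succinctHittingSetsForVP_iff_allDegrees :
    SuccinctHittingSetsForVP F ↔
      ∀ a : ℕ, ∃ b n₀ : ℕ, ∀ n : ℕ, n₀ ≤ n → ∀ d : ℕ,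
        IsSuccinctHittingSet (monomialsDegLE n d) (vpSlice F n d ((n + d) ^ b))
          {P : MvPolynomial (monomialsDegLE n d) F |
            complexity P ≤ ((n + d).choose n) ^ a ∧ P.totalDegree ≤ ((n + d).choose n) ^ a} :=
  ⟨succinctHittingSetsForVP_allDegrees, succinctHittingSetsForVP_of_allDegrees⟩

/-- **Equations for `VP` in ANY degree regime deny the barrier hypothesis** (the all-degrees form
of the CHECK file's `not_succinctHittingSetsForVP_of_hasEfficientEquations`, whose
`HasEfficientEquations` is the `d(n) = n` instance): if for some degree function `d : ℕ → ℕ` and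
some constructivity level `a` there is a family `P_n` of nonzero polynomials in the
`N = binom(n + d(n), n)` coefficient variables of size and degree `≤ N^a` (eventually) which, for
every size exponent `b`, vanishes eventually on the coefficient vectors of the degree-`≤ d(n)`
polynomials of circuit size `≤ (n + d(n))^b` (`vpSlice`), then `SuccinctHittingSetsForVP F` fails.
So an algebraically natural lower-bound proof against `poly(n,d)`-size circuits in ANY degree
regime `d(n)` — constant, logarithmic, polynomial, … — is excluded by the route hypothesis
`BarrierLever.SuccinctHittingSetsForVP`, not only one at `d = n`.
[cite: ForbesShpilkaVolk2018, Question 6 and Cor. 5] locator: paper:arxiv-1701.05328 p0008.txt:L31–39 -/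
theorem not_succinctHittingSetsForVP_of_equations_anyDegree (d : ℕ → ℕ) (a : ℕ)
    (P : (n : ℕ) → MvPolynomial (monomialsDegLE n (d n)) F)
    (hP : ∃ n₁ : ℕ, ∀ n : ℕ, n₁ ≤ n → P n ≠ 0 ∧
      complexity (P n) ≤ ((n + d n).choose n) ^ a ∧ (P n).totalDegree ≤ ((n + d n).choose n) ^ a)
    (hvan : ∀ b : ℕ, ∃ n₀ : ℕ, ∀ n : ℕ, n₀ ≤ n →
      ∀ f ∈ vpSlice F n (d n) ((n + d n) ^ b),
        eval (coeffVector (monomialsDegLE n (d n)) f) (P n) = 0) :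
    ¬ SuccinctHittingSetsForVP F := by
  intro hyp
  obtain ⟨b, n₂, hb⟩ := succinctHittingSetsForVP_allDegrees hyp a
  obtain ⟨n₁, hn₁⟩ := hP
  obtain ⟨n₀, hn₀⟩ := hvan b
  obtain ⟨hne, hc, hdeg⟩ := hn₁ (max (max n₀ n₁) n₂) ((le_max_right _ _).trans (le_max_left _ _))
  obtain ⟨f, hf, hfne⟩ :=
    hb (max (max n₀ n₁) n₂) (le_max_right _ _) (d _) (P _) ⟨hc, hdeg⟩ hne
  exact hfne (hn₀ _ ((le_max_left _ _).trans (le_max_left _ _)) f hf)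

end Padding

end Literature.Barriers.ValiantsHypothesis

end
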